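import Summits.Ventures.PercRepro.ProfileGapMonoThresholdCorankTwo

/-!
# PercRepro — THE TOP THRESHOLD AT NULLITY `3`, STEP 1: the demanding sets are cobases, their long planes have one
extra point, and every transversal triple of the complement is a slack unit (p5, gen 31; `proofs/P5-GM1.md` §43(d),(f))

At nullity `#E = ρ(E) + 3` and co-rank `q = 4`, a demanding set `B` (rank `3`, spanning complement) has exactly three
points and `E ∖ B` is a basis (`card_eq_three_of_nullity_three`); on a coloop-free matroid its plane has at most
`5` points (`card_clF_le_five_of_coloopFree`, from §40's excess bound), so with no `5`-point plane a deficient `B` has a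
plane `cl B = B ∪ {p}` with one extra point (`exists_eq_insert_of_card_clF_eq_four`).  For such `B`, `p` and a triple
`Y` of the complement `O = E ∖ cl B` of co-rank `ρ(E) − 1`, the set `Y ∪ p ⊆ E ∖ B` is independent of rank `4`
(`rk_insert_eq_four_of_subset_basis`), so the slack lemma of CorankTwo applies: **`unit_of_nullity_three`** — `Y ∪ p`
is a boundary target of the top threshold with `p` a coloop of it inside the closure of its complement.  This is the
map `(B, Y) ↦ (Y ∪ p, p)` of §43(f); its fibre bound and the class bound are the next steps.  Nothing open is asserted.
-/

open scoped Matroid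

namespace PercRepro.Cogirth

open Finset ThmH Skew Shadow Profile

variable {α : Type} [DecidableEq α] {N : Matroid α} [N.Finite]

section NullityThree

variable (hn : (gr N).card = rk N (gr N) + 3)

include hn in
/-- **At nullity `3` a demanding rank-`3` set has three points and a basis as complement**: `B ∈ Rq N 3` with
`ρ(E ∖ B) = ρ(E)` gives `#B = 3` and `#(E ∖ B) = ρ(E)`. -/
theorem card_eq_three_of_nullity_three {B : Finset α} (hB : B ∈ Rq N 3) (hBsp : rk N (gr N \ B) = rk N (gr N)) :
    B.card = 3 ∧ (gr N \ B).card = rk N (gr N) := by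
  obtain ⟨hBg, hBr⟩ := mem_Rq.1 hB
  have hrk : rk N B = 3 := rk_eq_of_eRk_eq hBr
  have h1 := card_sdiff_add_card_eq_card hBg
  have h2 := rk_le_card' (M := N) (gr N \ B)
  have h3 := rk_le_card' (M := N) B
  omega

include hn in
/-- **On a coloop-free matroid of nullity `3` the plane of a demanding set has at most `5` points** (§40's excess
bound `ρ(E ∖ B) ≤ #(E ∖ cl B) + 2`). -/
theorem card_clF_le_five_of_coloopFree (hcf : ∀ z ∈ gr N, rk N ((gr N).erase z) = rk N (gr N))
    (hR : 4 ≤ rk N (gr N)) {B : Finset α} (hB : B ∈ Rq N 3) (hBsp : rk N (gr N \ B) = rk N (gr N)) :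
    (clF N B).card ≤ 5 := by
  have h := rk_sdiff_le_card_sdiff_clF_add_of_coloopFree (q := 4) (by norm_num) hcf hB (by omega)
  have h1 := card_sdiff_add_card_eq_card (clF_subset_gr (M := N) B)
  omega

/-- A plane of exactly four points through a three-point set is that set plus one point. -/
theorem exists_eq_insert_of_card_clF_eq_four {B : Finset α} (hBg : B ⊆ gr N) (hB3 : B.card = 3)
    (h4 : (clF N B).card = 4) : ∃ p ∉ B, clF N B = insert p B := by
  obtain ⟨p, hp, hpB⟩ := exists_eq_insert_iff.2 ⟨subset_clF hBg, by omega⟩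
  exact ⟨p, hp, hpB.symm⟩

/-- **`Y ∪ p` is independent of rank `4`** when `E ∖ B` is a basis, `Y ⊆ E ∖ cl B` has three points and
`p ∈ cl B ∖ B`. -/
theorem rk_insert_eq_four_of_subset_basis {B : Finset α} (hBg : B ⊆ gr N)
    (hbasis : rk N (gr N \ B) = (gr N \ B).card) {Y : Finset α} (hY : Y ⊆ gr N \ clF N B) (hYc : Y.card = 3)
    {p : α} (hp : p ∈ clF N B) (hpB : p ∉ B) : rk N (insert p Y) = 4 := by
  have hpY : p ∉ Y := fun h => (mem_sdiff.1 (hY h)).2 hp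
  have hsub : insert p Y ⊆ gr N \ B := by
    intro w hw
    rcases mem_insert.1 hw with rfl | hw
    · exact mem_sdiff.2 ⟨clF_subset_gr B hp, hpB⟩
    · exact mem_sdiff.2 ⟨(mem_sdiff.1 (hY hw)).1, fun hwB => (mem_sdiff.1 (hY hw)).2 (subset_clF hBg hwB)⟩
  rw [rk_eq_card_of_subset_of_rk_eq_card' hbasis hsub, card_insert_of_notMem hpY, hYc]

include hn in
/-- **THE SLACK UNITS AT NULLITY `3`**: for a demanding `B` whose plane is `B ∪ {p}`, every triple `Y` of the
complement `E ∖ cl B` of co-rank `ρ(E) − 1` gives a boundary target `Y ∪ p` of the top threshold (co-rank `4`) with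
`p` a coloop of `Y ∪ p` inside the closure of its complement. -/
theorem unit_of_nullity_three {B : Finset α} (hB : B ∈ Rq N 3) (hBsp : rk N (gr N \ B) = rk N (gr N))
    {p : α} (hp : p ∈ clF N B) (hpB : p ∉ B) {Y : Finset α} (hY : Y ⊆ gr N \ clF N B) (hYc : Y.card = 3)
    (hYco : rk N (gr N \ Y) + 1 = rk N (gr N)) :
    insert p Y ∈ levelSetCoQ N (rk N (gr N) - 1) 4 ∧
      p ∈ coloops N (insert p Y) ∩ clF N (gr N \ insert p Y) := by
  obtain ⟨_, hcard⟩ := card_eq_three_of_nullity_three hn hB hBsp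
  have hbasis : rk N (gr N \ B) = (gr N \ B).card := by rw [hBsp, hcard]
  have hS : rk N (insert p Y) = 4 :=
    rk_insert_eq_four_of_subset_basis (mem_Rq.1 hB).1 hbasis hY hYc hp hpB
  have hB' : B ∈ Rq N (4 - 1) := hB
  have hYc' : Y.card = 4 - 1 := hYc
  exact ⟨insert_mem_levelSetCoQ_top hB' hY hYco hp hpB hS,
    mem_coloops_inter_clF_of_corank_two hB' hY hYc' hp hpB hS (by norm_num)⟩

end NullityThree

end PercRepro.Cogirth
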